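import Literature.NumberTheory.Weil1964.AdelicSchwartzDominatedOfDecay
import Literature.NumberTheory.Weil1964.ArchSectionThetaMajorants
import HarnessLib

/-!
# Dominated families III: Weil's Lemme 5, pointwise adelic form — on a compact set the functions `ω(S)Φ` are
# dominated by ONE Schwartz–Bruhat function

Topic `NumberTheory/Weil1964`; namespace `Literature.NumberTheory.Weil1964`.  KERNEL mathematics only (theorems; no
definition, no named fact, no `axiom`, no proof hole).

[Weil1964, Chap. III n° 41, Lemme 5 p. 194]: «Soit `Ω` une partie compacte de `Mp(X)_A`, et soit `Φ ∈ 𝒮(X_A)`.  Il existe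
alors `Φ₀ ∈ 𝒮(X_A)` telle que l'on ait `|SΦ(x)| ≤ Φ₀(x)` quels que soient `x ∈ X_A` et `S ∈ Ω`.»  The tree proves the
LOCAL DECAY DATA form of this lemma for every representation it uses — near each point of the group all `ρ(g)Φ` obey
ONE bound `M (1 + ‖x_∞‖)^{-k}` (every `k`) and vanish off ONE compact set of finite parts: ★ `IsTensorAction.exists_decay`
(tensor actions `A ⊗ B`, `AdelicThetaTensorMajorants`) and ★ `AdelicMetaplecticThetaMajorants.decay_near` (the Weil
representation `h ↦ ω_ψ(s h)` along a continuous homomorphism into `Mp_ψ(W_𝔸)ᶜᵒⁿᵗ` with an archimedean covariant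
family) — and consumes it over RATIONAL points (`HasThetaMajorants.of_decay`).  With the decay-to-majorant bridge of
★ `AdelicSchwartzDominatedOfDecay` this file states the POINTWISE ADELIC Lemme 5 itself:

* `exists_piSchwartzBruhat_dominating_of_locally_uniform_decay` — a family `f : G → 𝒮(𝔸_Fⁿ)` with locally uniform
  decay data of every order is dominated on every compact `C ⊆ G` by ONE real non-negative `Φ₀ ∈ 𝒮(𝔸_Fⁿ)`
  (finite subcover; `max` of the bounds, union of the finite-part supports);
* `IsTensorAction.exists_piSchwartzBruhat_dominating` — for every tensor action (in particular ★ `adelicTensorRep`,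
  ★ `adelicRep` of a strongly continuous archimedean and a smooth finite factor, `AdelicThetaTensorRep`);
* `exists_piSchwartzBruhat_dominating_omega_comp` — **for `h ↦ ω_ψ(s h)Φ` along a continuous homomorphism
  `s : H →* Mp_ψ(W_𝔸)ᶜᵒⁿᵗ` with archimedean covariant data (the hypotheses of ★ `hasThetaMajorants_omega_comp`), every
  compact `C ⊆ H` and every `Φ ∈ 𝒮(𝔸_Fⁿ)`: `‖(ω(s h)Φ)(x)‖ ≤ (Φ₀ x).re` for all `h ∈ C`, `x ∈ 𝔸_Fⁿ`;** and the same
  from an archimedean implementer SECTION (`…_of_section`, `…_of_section_comp`) or from `KAK` implementer data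
  (`…_of_kakData`) — the hypotheses of ★ `ArchSectionThetaMajorants.hasThetaMajorants_omega_comp_of_section{,_comp}` ∕
  `…_of_kakData` VERBATIM, so every consumer of those theorems (e.g. ★ `hasThetaMajorants_omega_pairSplitting` for the
  unitary dual pairs: same argument list with `hasThetaMajorants_omega_comp_of_kakData` replaced by
  `exists_piSchwartzBruhat_dominating_omega_comp_of_kakData`) gets the pointwise majorant with no new input.

This is input (C3) DOM of the boundedness argument [Weil1965, Chap. V n° 50] in the cell's E-2 engine (the positive
measures `Î`, `E_X` are evaluated at `|ω(k̃)Ψ|`, `k̃` in a compact).  Cell hodgecm-mathlib, FLOOR 0, crux item H413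
(`--supports stmt-HodgeConjecture-24833`), row G3.  HC_CM is proved only modulo the printed citations until rung 0
closes; nothing here is about Hodge classes.

## References
* [Weil1964] A. Weil, *Sur certains groupes d'opérateurs unitaires*, Acta Math. 111 (1964) 143–211, Chap. III n° 41,
  Lemme 5 p. 194, Théorème 6 p. 193.
* [Weil1965] A. Weil, *Sur la formule de Siegel dans la théorie des groupes classiques*, Acta Math. 113 (1965) 1–87,
  Chap. V n° 50.
-/

set_option autoImplicit false

noncomputable section

open scoped BigOperators NNReal Matrix Topology Classical SchwartzMap
open NumberField NumberField.mixedEmbedding IsDedekindDomain Set Filter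

namespace Literature.NumberTheory.Weil1964

open Literature.NumberTheory.Automorphic Literature.Analysis.Distribution

/-! ## §1 Locally uniform decay data on a compact set ⇒ one Schwartz–Bruhat majorant -/

section Local

variable (F : Type) [Field F] [NumberField F] {n : ℕ} {G : Type*} [TopologicalSpace G]

/-- **From locally uniform decay (one order) to uniform decay on a compact set**: finite subcover, the largest of the
finitely many constants, the union of the finitely many compact sets of finite parts. [cite: Weil1964, Chap. III n° 41, Lemme 5 p. 194] -/
theorem exists_uniform_decay_of_isCompact (f : G → piSchwartzBruhat F (Fin n)) (k : ℕ)
    (hd : ∀ g₀ : G, ∃ V ∈ 𝓝 g₀, ∃ (M : ℝ) (Cf : Set (Fin n → FiniteAdeleRing (𝓞 F) F)), 0 ≤ M ∧ IsCompact Cf ∧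
      ∀ g ∈ V,
        (∀ x, ‖((f g : piSchwartzBruhat F (Fin n)) : (Fin n → AdeleRing (𝓞 F) F) → ℂ) x‖ ≤
            M * (1 + ‖vecInfinitePart F n x‖) ^ (-(k : ℝ))) ∧
        (∀ x, vecFinitePart F n x ∉ Cf → ((f g : piSchwartzBruhat F (Fin n)) : (Fin n → AdeleRing (𝓞 F) F) → ℂ) x = 0))
    {C : Set G} (hC : IsCompact C) :
    ∃ (M : ℝ) (Cf : Set (Fin n → FiniteAdeleRing (𝓞 F) F)), 0 ≤ M ∧ IsCompact Cf ∧ ∀ g ∈ C,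
      (∀ x, ‖((f g : piSchwartzBruhat F (Fin n)) : (Fin n → AdeleRing (𝓞 F) F) → ℂ) x‖ ≤
          M * (1 + ‖vecInfinitePart F n x‖) ^ (-(k : ℝ))) ∧
      (∀ x, vecFinitePart F n x ∉ Cf → ((f g : piSchwartzBruhat F (Fin n)) : (Fin n → AdeleRing (𝓞 F) F) → ℂ) x = 0) := by
  choose V hV M Cf hM0 hCfc hdec using hd
  obtain ⟨t, htC, hcover⟩ := hC.elim_nhds_subcover V fun g _ => hV g
  refine ⟨∑ g ∈ t, M g, ⋃ g ∈ t, Cf g, Finset.sum_nonneg fun g _ => hM0 g,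
    t.finite_toSet.isCompact_biUnion fun g _ => hCfc g, fun g hg => ?_⟩
  obtain ⟨g₀, hg₀t, hgV⟩ := Set.mem_iUnion₂.1 (hcover hg)
  obtain ⟨h1, h2⟩ := hdec g₀ g hgV
  refine ⟨fun x => (h1 x).trans ?_, fun x hx => h2 x fun hx' => hx (Set.mem_iUnion₂.2 ⟨g₀, hg₀t, hx'⟩)⟩
  exact mul_le_mul_of_nonneg_right (Finset.single_le_sum (fun g _ => hM0 g) hg₀t) (by positivity)

/-- **Weil's Lemme 5, pointwise adelic form, from decay data**: a family `f : G → 𝒮(𝔸_Fⁿ)` with locally uniform decay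
data of EVERY order is dominated on each compact `C ⊆ G` by ONE `Φ₀ ∈ 𝒮(𝔸_Fⁿ)` with `(Φ₀ x).im = 0 ≤ (Φ₀ x).re`:
`‖(f g)(x)‖ ≤ (Φ₀ x).re` for all `g ∈ C`, `x`. [cite: Weil1964, Chap. III n° 41, Lemme 5 p. 194] [cite: Weil1965, Chap. V n° 50] -/
theorem exists_piSchwartzBruhat_dominating_of_locally_uniform_decay (f : G → piSchwartzBruhat F (Fin n))
    (hd : ∀ (k : ℕ) (g₀ : G), ∃ V ∈ 𝓝 g₀, ∃ (M : ℝ) (Cf : Set (Fin n → FiniteAdeleRing (𝓞 F) F)),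
      0 ≤ M ∧ IsCompact Cf ∧ ∀ g ∈ V,
        (∀ x, ‖((f g : piSchwartzBruhat F (Fin n)) : (Fin n → AdeleRing (𝓞 F) F) → ℂ) x‖ ≤
            M * (1 + ‖vecInfinitePart F n x‖) ^ (-(k : ℝ))) ∧
        (∀ x, vecFinitePart F n x ∉ Cf → ((f g : piSchwartzBruhat F (Fin n)) : (Fin n → AdeleRing (𝓞 F) F) → ℂ) x = 0))
    {C : Set G} (hC : IsCompact C) :
    ∃ Φ₀ : (Fin n → AdeleRing (𝓞 F) F) → ℂ, Φ₀ ∈ piSchwartzBruhat F (Fin n) ∧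
      (∀ x, (Φ₀ x).im = 0 ∧ 0 ≤ (Φ₀ x).re) ∧
        ∀ g ∈ C, ∀ x, ‖((f g : piSchwartzBruhat F (Fin n)) : (Fin n → AdeleRing (𝓞 F) F) → ℂ) x‖ ≤ (Φ₀ x).re := by
  have hu := fun k : ℕ => exists_uniform_decay_of_isCompact F f k (hd k) hC
  choose M Cf hM0 hCfc hdec using hu
  exact exists_piSchwartzBruhat_dominating_of_uniform_decay F (T := C)
    (fun g => ((f g : piSchwartzBruhat F (Fin n)) : (Fin n → AdeleRing (𝓞 F) F) → ℂ)) M (hCfc 0)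
    (fun k g hg x => (hdec k g hg).1 x) (fun g hg x hx => (hdec 0 g hg).2 x hx)

end Local

/-! ## §2 Tensor actions -/

section Tensor

variable {F : Type} [Field F] [NumberField F] {n : ℕ} {G : Type*} [TopologicalSpace G]
  {ρ : G → Module.End ℂ (piSchwartzBruhat F (Fin n))}
  {A : G → SchwartzMap (Fin n → mixedSpace F) ℂ → SchwartzMap (Fin n → mixedSpace F) ℂ}
  {B : G → ((Fin n → FiniteAdeleRing (𝓞 F) F) → ℂ) → ((Fin n → FiniteAdeleRing (𝓞 F) F) → ℂ)}

/-- **Weil's Lemme 5 for tensor actions**: for a tensor action `ρ = A ⊗ B` (archimedean factor with locally uniform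
Schwartz decay, locally constant finite factor), every `Φ ∈ 𝒮(𝔸_Fⁿ)` and every compact `C ⊆ G`, ONE real non-negative
`Φ₀ ∈ 𝒮(𝔸_Fⁿ)` dominates all `ρ(g)Φ`, `g ∈ C`, pointwise on `𝔸_Fⁿ` (★ `IsTensorAction.exists_decay` at every order).
[cite: Weil1964, Chap. III n° 41, Lemme 5 p. 194] -/
theorem IsTensorAction.exists_piSchwartzBruhat_dominating (h : IsTensorAction ρ A B)
    (Φ : piSchwartzBruhat F (Fin n)) {C : Set G} (hC : IsCompact C) :
    ∃ Φ₀ : (Fin n → AdeleRing (𝓞 F) F) → ℂ, Φ₀ ∈ piSchwartzBruhat F (Fin n) ∧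
      (∀ x, (Φ₀ x).im = 0 ∧ 0 ≤ (Φ₀ x).re) ∧
        ∀ g ∈ C, ∀ x, ‖((ρ g Φ : piSchwartzBruhat F (Fin n)) : (Fin n → AdeleRing (𝓞 F) F) → ℂ) x‖ ≤ (Φ₀ x).re :=
  exists_piSchwartzBruhat_dominating_of_locally_uniform_decay F (fun g => ρ g Φ)
    (fun k g₀ => h.exists_decay Φ k g₀) hC

end Tensor

/-! ## §3 The Weil representation along a continuous homomorphism into `Mp_ψ(W_𝔸)ᶜᵒⁿᵗ` -/

section Metaplectic

variable {F : Type} [Field F] [NumberField F] {n : ℕ} {T : Matrix (Fin n) (Fin n) (AdeleRing (𝓞 F) F)}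
  {H : Type*} [Group H] [TopologicalSpace H] [IsTopologicalGroup H]

/-- **Weil's Lemme 5, pointwise adelic form, for `h ↦ ω_ψ(s h)`** along a continuous homomorphism
`s : H →* Mp_ψ(W_𝔸)ᶜᵒⁿᵗ` (`T` invertible) with an archimedean `ψ_∞`-covariant family `W_∞` (the data of
★ `hasThetaMajorants_omega_comp`): for every `Φ ∈ 𝒮(𝔸_Fⁿ)` and compact `C ⊆ H` there is a real non-negative
`Φ₀ ∈ 𝒮(𝔸_Fⁿ)` with `‖(ω(s h)Φ)(x)‖ ≤ (Φ₀ x).re` for all `h ∈ C` and all `x ∈ 𝔸_Fⁿ`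
(★ `AdelicMetaplecticThetaMajorants.decay_near` at every order). [cite: Weil1964, Chap. III n° 41, Lemme 5 p. 194] [cite: Weil1965, Chap. V n° 50] -/
theorem exists_piSchwartzBruhat_dominating_omega_comp (hT : IsUnit T) (s : H →* adelicMpCont F (Fin n) T)
    (hs : Continuous s)
    (Winf : H → (𝓢((Fin n → mixedSpace F), ℂ) →L[ℂ] 𝓢((Fin n → mixedSpace F), ℂ)))
    (w0 : ∀ h, Winf h ≠ 0) (w1 : ∀ Φ, Continuous fun h => Winf h Φ)
    (w2 : ∀ (h : H) (a w : Fin n → mixedSpace F) (Φ : 𝓢((Fin n → mixedSpace F), ℂ)),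
      Winf h (archModTrans F (Fin n) T a w Φ) =
        weilPhase T (adelicMpCont.proj F (Fin n) T (s h)) (a, w) •
          archModTrans F (Fin n) T (archAct T (adelicMpCont.proj F (Fin n) T (s h)) (a, w)).1
            (archAct T (adelicMpCont.proj F (Fin n) T (s h)) (a, w)).2 (Winf h Φ))
    (Φ : piSchwartzBruhat F (Fin n)) {C : Set H} (hC : IsCompact C) :
    ∃ Φ₀ : (Fin n → AdeleRing (𝓞 F) F) → ℂ, Φ₀ ∈ piSchwartzBruhat F (Fin n) ∧
      (∀ x, (Φ₀ x).im = 0 ∧ 0 ≤ (Φ₀ x).re) ∧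
        ∀ h ∈ C, ∀ x, ‖((adelicMpCont.omega F (Fin n) T (s h) Φ : piSchwartzBruhat F (Fin n)) :
          (Fin n → AdeleRing (𝓞 F) F) → ℂ) x‖ ≤ (Φ₀ x).re :=
  exists_piSchwartzBruhat_dominating_of_locally_uniform_decay F (fun h => adelicMpCont.omega F (Fin n) T (s h) Φ)
    (fun k h₀ => decay_near hT s (map_mul s) hs Winf w0 w1 w2 Φ k h₀) hC

end Metaplectic

/-! ## §4 From an archimedean implementer section ∕ `KAK` implementer data (the consumers' hypotheses verbatim) -/

section Section

open Literature.Analysis.SegalBargmann Literature.RepresentationTheory.HeisenbergGroup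

variable {F : Type} [Field F] [NumberField F] {n : ℕ} {T : Matrix (Fin n) (Fin n) (AdeleRing (𝓞 F) F)}
  {H : Type*} [Group H] [TopologicalSpace H] [IsTopologicalGroup H]
  {σ : Type*} [Fintype σ]

/-- **Lemme 5 pointwise from an archimedean implementer section** (data of
★ `hasThetaMajorants_omega_comp_of_section`: `N h ≠ 0`, orbit maps continuous, `N h` implements the Folland-coordinate
phase map of `π(s h)` in the frame `e`). [cite: Weil1964, Chap. III n° 41, Lemme 5 p. 194] -/
theorem exists_piSchwartzBruhat_dominating_omega_comp_of_section (hT : IsUnit T)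
    (s : H →* adelicMpCont F (Fin n) T) (hs : Continuous s) (e : (Fin n → mixedSpace F) ≃L[ℝ] (σ → ℝ))
    (hT' : IsUnit (archMat F (Fin n) T)) (N : H → (SchwartzMap (σ → ℝ) ℂ →L[ℂ] SchwartzMap (σ → ℝ) ℂ))
    (n0 : ∀ h, N h ≠ 0) (n1 : ∀ f : SchwartzMap (σ → ℝ) ℂ, Continuous fun h => N h f)
    (n2 : ∀ (h : H) (p q : σ → ℝ) (f : SchwartzMap (σ → ℝ) ℂ), N h (rhoS p q f) =
      rhoS (archPhaseMap T e hT' (adelicMpCont.proj F (Fin n) T (s h)) (p, q)).1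
        (archPhaseMap T e hT' (adelicMpCont.proj F (Fin n) T (s h)) (p, q)).2 (N h f))
    (Φ : piSchwartzBruhat F (Fin n)) {C : Set H} (hC : IsCompact C) :
    ∃ Φ₀ : (Fin n → AdeleRing (𝓞 F) F) → ℂ, Φ₀ ∈ piSchwartzBruhat F (Fin n) ∧
      (∀ x, (Φ₀ x).im = 0 ∧ 0 ≤ (Φ₀ x).re) ∧
        ∀ h ∈ C, ∀ x, ‖((adelicMpCont.omega F (Fin n) T (s h) Φ : piSchwartzBruhat F (Fin n)) :
          (Fin n → AdeleRing (𝓞 F) F) → ℂ) x‖ ≤ (Φ₀ x).re :=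
  exists_piSchwartzBruhat_dominating_omega_comp hT s hs (fun h => carrierConj e (N h))
    (fun h => carrierConj_ne_zero e (n0 h)) (fun Φ => continuous_carrierConj_apply e n1 Φ)
    (fun h a w Φ => arch_implements_of_covariant_rhoSD_clm T e hT' (adelicMpCont.proj F (Fin n) T (s h))
      (carrierConj e (N h)) (fun p q Ψ => carrierConj_rhoSD e (n2 h) p q Ψ) a w Φ) Φ hC

variable {G : Type*} [TopologicalSpace G] {K : Type*} [TopologicalSpace K] {P : Type*} [TopologicalSpace P]

/-- **… along a continuous map into a space carrying the section** (data of
★ `hasThetaMajorants_omega_comp_of_section_comp`). [cite: Weil1964, Chap. III n° 41, Lemme 5 p. 194] -/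
theorem exists_piSchwartzBruhat_dominating_omega_comp_of_section_comp (hT : IsUnit T)
    (s : H →* adelicMpCont F (Fin n) T) (hs : Continuous s) (e : (Fin n → mixedSpace F) ≃L[ℝ] (σ → ℝ))
    (hT' : IsUnit (archMat F (Fin n) T)) {γ : G → PhaseMap σ}
    (N₀ : G → (SchwartzMap (σ → ℝ) ℂ →L[ℂ] SchwartzMap (σ → ℝ) ℂ)) (n0 : ∀ g, N₀ g ≠ 0)
    (n1 : ∀ f : SchwartzMap (σ → ℝ) ℂ, Continuous fun g => N₀ g f) (n2 : ∀ g, IsImplementerS (γ g) (N₀ g))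
    (ϖ : H → G) (hϖ : Continuous ϖ)
    (hγ : ∀ h, archPhaseMap T e hT' (adelicMpCont.proj F (Fin n) T (s h)) = γ (ϖ h))
    (Φ : piSchwartzBruhat F (Fin n)) {C : Set H} (hC : IsCompact C) :
    ∃ Φ₀ : (Fin n → AdeleRing (𝓞 F) F) → ℂ, Φ₀ ∈ piSchwartzBruhat F (Fin n) ∧
      (∀ x, (Φ₀ x).im = 0 ∧ 0 ≤ (Φ₀ x).re) ∧
        ∀ h ∈ C, ∀ x, ‖((adelicMpCont.omega F (Fin n) T (s h) Φ : piSchwartzBruhat F (Fin n)) :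
          (Fin n → AdeleRing (𝓞 F) F) → ℂ) x‖ ≤ (Φ₀ x).re :=
  exists_piSchwartzBruhat_dominating_omega_comp_of_section hT s hs e hT' (fun h => N₀ (ϖ h)) (fun h => n0 (ϖ h))
    (fun f => (n1 f).comp hϖ) (fun h p q f => by rw [hγ h]; exact (n2 (ϖ h)).1 p q f) Φ hC

/-- **Lemme 5 pointwise from `KAK` implementer data** (data of ★ `hasThetaMajorants_omega_comp_of_kakData`, the
form used by the unitary dual pairs ★ `hasThetaMajorants_omega_pairSplitting`): the archimedean family is the
vacuum-normalised section `carrierConj e (vacSection γ (ϖ h))`. [cite: Weil1964, Chap. III n° 41, Lemme 5 p. 194] [cite: Weil1965, Chap. V n° 50] -/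
theorem exists_piSchwartzBruhat_dominating_omega_comp_of_kakData (hT : IsUnit T)
    (s : H →* adelicMpCont F (Fin n) T) (hs : Continuous s) (e : (Fin n → mixedSpace F) ≃L[ℝ] (σ → ℝ))
    (hT' : IsUnit (archMat F (Fin n) T)) [DecidableEq σ] [Monoid G]
    {γ : G → PhaseMap σ} {κ : K → G} {a : P → G}
    {WK : K → (SchwartzMap (σ → ℝ) ℂ →L[ℂ] SchwartzMap (σ → ℝ) ℂ)}
    {WA : P → (SchwartzMap (σ → ℝ) ℂ →L[ℂ] SchwartzMap (σ → ℝ) ℂ)} (Dk : KAKImplementerData γ κ a WK WA)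
    (ϖ : H → G) (hϖ : Continuous ϖ)
    (hγ : ∀ h, archPhaseMap T e hT' (adelicMpCont.proj F (Fin n) T (s h)) = γ (ϖ h))
    (Φ : piSchwartzBruhat F (Fin n)) {C : Set H} (hC : IsCompact C) :
    ∃ Φ₀ : (Fin n → AdeleRing (𝓞 F) F) → ℂ, Φ₀ ∈ piSchwartzBruhat F (Fin n) ∧
      (∀ x, (Φ₀ x).im = 0 ∧ 0 ≤ (Φ₀ x).re) ∧
        ∀ h ∈ C, ∀ x, ‖((adelicMpCont.omega F (Fin n) T (s h) Φ : piSchwartzBruhat F (Fin n)) :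
          (Fin n → AdeleRing (𝓞 F) F) → ℂ) x‖ ≤ (Φ₀ x).re :=
  exists_piSchwartzBruhat_dominating_omega_comp_of_section_comp hT s hs e hT' (vacSection γ) Dk.vacSection_ne_zero
    Dk.continuous_apply_vacSection Dk.isImplementerS_vacSection ϖ hϖ hγ Φ hC

end Section

end Literature.NumberTheory.Weil1964
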